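import Summits.BirchSwinnertonDyer.Rank1Residual.GaloisImage.HauptmodulThreeQuarticValuation
import HarnessLib

/-!
# The non-canonical root of the level-`3` Hauptmodul quartic at `v₃(j) = 5`:
# `v(ρ)³ = v(3)²` and `v(F₋ F₊) = v(3)⁴ v(ρ)` for the two factors of `(2 + ρ)²ρ⁶ − 81`
# (cell `b2b-bsdres`, team n1011, seat p02 gen 5 — row T-b11-F4, file F4c-H6 'Hauptmodul route,
# curve-free core at v₃(j) = 5, part 1'; pure valuation algebra in `ℚ̄`)

HONEST FRAMING (cell `b2b-bsdres`, run/shared/lean/b2b/bsd-rank1-residual/, verbatim in every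
file): the goal of the cell is to DELETE the COMBINATION-SHAPED residual classes of the
Birch–Swinnerton-Dyer formula for ALL analytic-rank `≤ 1` elliptic curves over `ℚ` — "full BSD
formula for every rank `≤ 1` curve in class `C`" assembled STRICTLY from published theorems — so
that the rank-`≤ 1` remainder becomes exactly the CONSTRUCTION-SHAPED classes, which are TYPED
(missing-input `Prop`s), NOT attempted. This is not "finishing BSD". Team n1011 (N10 / N11):
research route; no claim beyond the stated classes; labels UNCHANGED; nothing is booked. Theorems
only (no definition, no named fact).

## What this file proves

`v` is the place of `ℚ̄` over `3`, `t = v(3)`.  The level-`3` relation `j(S − 27) = S(S − 24)³`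
for `ρ = S/3 − 2` and `K = j/243` reads `ρ⁴ − 16ρ³ + 72ρ² − 9Kρ + (63K − 432) = 0`
(`HauptmodulThreeQuarticValuation.rho_quartic_of_hauptmodul_three` with `J = 3K`).  At `v₃(j) = 5`
the parameter `K` is a `3`-adic unit, so `K ≡ ±1 (mod 3)`.

* `valuation_rho_pow_three_eq_sq` (§1) — `v(K) = 1`, `v(ρ + 2) = 1` and the quartic ⟹
  **`v(ρ)³ = t²`** (the non-canonical roots have `3`-adic valuation `2/3`).
* `valuation_factors_of_quartic_five` (§2) — with
  `F₋ = 126(K − 8) + 9ρ(5K − 47) + 9ρ²(16 − K) + 72ρ³` and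
  `F₊ = 18(7K − 40) + 9ρ(5K − 49) + 9ρ²(16 − K) + 72ρ³`
  (so that `F∓ = R(2 + ρ) ∓ 9(16 − ρ)` for `R = 72ρ² − 9Kρ + 63K − 432 = ρ³(16 − ρ)`):
  **`v(F₋)·v(F₊) = t⁴·v(ρ)`** — for `K ≡ −1 (mod 3)` the linear term dominates `F₋` and the
  constant term dominates `F₊`, for `K ≡ 1 (mod 3)` the other way round.

Part 2 (`HauptmodulNineValuationFive`) concludes: `(X³ − 1)·81(16 − ρ)² = F₋F₊` for
`X = θ²ρ²/9 = (θ(S − 6)/9)²` (`θ³ = S`), hence `v(X³ − 1)³ = t²` and, by the cube-root lemma,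
`v(X − 1)⁹ = t²`: the `Stab(C)`-invariant `(θ(θ³ − 6)/9)² − 1` has `3`-adic valuation `2/9` on
the family `v₃(j) = 5` of the EXOTIC core (117 census cells; EVIDENCE kit j134538, 117/117).
Nothing booked.

References: [Maier2006] Table 4 (N = 3, 9), §5.
-/

noncomputable section

set_option maxRecDepth 10000

open scoped Classical

namespace Summit.BirchSwinnertonDyer.Rank1Residual.GaloisImage

open Literature.NumberTheory.EllipticCurves Literature.NumberTheory.GaloisRepresentations
  Rat.HeightOneSpectrum

/-! ### §1 `v(ρ)³ = v(3)²` at `v₃(j) = 5` -/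

/-- **`v(ρ)³ = v(3)²`** for a root `ρ` of `ρ⁴ − 16ρ³ + 72ρ² − 9Kρ + (63K − 432)` with `v(K) = 1`
and `v(ρ + 2) = 1` (the non-canonical roots at `v₃(j) = 5`, `K = j/3⁵`).  Upper bound from
`ρ³(16 − ρ) = 72ρ² − 9Kρ + 63K − 432`; lower bound: otherwise `63K` (valuation `t²`) dominates
the quartic. [folklore] -/
theorem valuation_rho_pow_three_eq_sq {ρ K : AlgebraicClosure ℚ}
    (hK : (placeOver 3).valuation K = 1) (hρ2 : (placeOver 3).valuation (ρ + 2) = 1)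
    (hr : ρ ^ 4 - 16 * ρ ^ 3 + 72 * ρ ^ 2 - 9 * K * ρ + (63 * K - 432) = 0) :
    (placeOver 3).valuation ρ ^ 3 = (placeOver 3).valuation (3 : AlgebraicClosure ℚ) ^ 2 := by
  set v := (placeOver 3).valuation with hv
  set t := v (3 : AlgebraicClosure ℚ) with ht
  have ht1 : t < 1 := valuation_three_lt_one
  have ht0 : t ≠ 0 := valuation_three_ne_zero
  have ht0' : 0 < t := zero_lt_iff.mpr ht0
  have hle1 : ∀ n : ℕ, v (n : AlgebraicClosure ℚ) ≤ 1 := fun n ↦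
    ((placeOver 3).valuation_le_one_iff _).mpr (natCast_mem (placeOver 3) n)
  have h9 : v (9 : AlgebraicClosure ℚ) = t ^ 2 := by
    rw [show (9 : AlgebraicClosure ℚ) = 3 ^ 2 by norm_num, map_pow]
  have h7 : v (7 : AlgebraicClosure ℚ) = 1 := by
    simpa using valuation_intCast_eq_one_of_not_dvd (n := 7) (by decide)
  have h63 : v (63 * K) = t ^ 2 := by
    rw [show (63 : AlgebraicClosure ℚ) = 7 * 3 ^ 2 by norm_num, map_mul, map_mul, map_pow, h7, hK,
      one_mul, mul_one]
  have h432 : v (432 : AlgebraicClosure ℚ) ≤ t ^ 3 := by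
    rw [show (432 : AlgebraicClosure ℚ) = 16 * 3 ^ 3 by norm_num, map_mul, map_pow]
    calc v 16 * t ^ 3 ≤ 1 * t ^ 3 := mul_le_mul' (by exact_mod_cast hle1 16) le_rfl
      _ = t ^ 3 := one_mul _
  have ht32 : t ^ 3 < t ^ 2 := by
    rw [pow_succ]
    calc t ^ 2 * t < t ^ 2 * 1 := mul_lt_mul_of_pos_left ht1 (pow_pos ht0' 2)
      _ = t ^ 2 := mul_one _
  -- `v(ρ) ≤ 1`, `v(16 − ρ) = 1`
  have hρ1 : v ρ ≤ 1 := by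
    have : ρ = (ρ + 2) - 2 := by ring
    rw [this]
    refine (Valuation.map_sub _ _ _).trans (max_le hρ2.le ?_)
    exact_mod_cast hle1 2
  have h16ρ : v (16 - ρ) = 1 := by
    have e : (16 : AlgebraicClosure ℚ) - ρ = 18 - (ρ + 2) := by ring
    have hlt : v (18 : AlgebraicClosure ℚ) < v (ρ + 2) := by
      rw [hρ2, show (18 : AlgebraicClosure ℚ) = 2 * 3 ^ 2 by norm_num, map_mul, map_pow]
      calc v 2 * t ^ 2 ≤ 1 * t ^ 2 := mul_le_mul' (by exact_mod_cast hle1 2) le_rfl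
        _ = t ^ 2 := one_mul _
        _ < 1 := pow_lt_one₀ zero_le ht1 two_ne_zero
    rw [e, valuation_sub_eq_of_lt' hlt, hρ2]
  -- upper bound
  have hR : v (72 * ρ ^ 2 - 9 * K * ρ + 63 * K - 432) ≤ t ^ 2 := by
    refine (Valuation.map_sub _ _ _).trans (max_le ?_ (h432.trans ht32.le))
    refine (Valuation.map_add _ _ _).trans (max_le ?_ h63.le)
    refine (Valuation.map_sub _ _ _).trans (max_le ?_ ?_)
    · rw [show (72 : AlgebraicClosure ℚ) = 8 * 3 ^ 2 by norm_num, map_mul, map_mul, map_pow, map_pow]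
      calc v 8 * t ^ 2 * v ρ ^ 2 ≤ 1 * t ^ 2 * 1 :=
            mul_le_mul' (mul_le_mul' (by exact_mod_cast hle1 8) le_rfl) (pow_le_one₀ zero_le hρ1)
        _ = t ^ 2 := by rw [one_mul, mul_one]
    · rw [map_mul, map_mul, h9, hK, mul_one]
      calc t ^ 2 * v ρ ≤ t ^ 2 * 1 := mul_le_mul' le_rfl hρ1
        _ = t ^ 2 := mul_one _
  have hup : v ρ ^ 3 ≤ t ^ 2 := by
    have hid : ρ ^ 3 * (16 - ρ) = 72 * ρ ^ 2 - 9 * K * ρ + 63 * K - 432 := by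
      linear_combination -hr
    have := congrArg v hid
    rw [map_mul, map_pow, h16ρ, mul_one] at this
    rw [this]; exact hR
  -- lower bound
  refine le_antisymm hup (not_lt.mp fun hlt ↦ ?_)
  have hρlt1 : v ρ < 1 := by
    by_contra h
    rw [not_lt] at h
    have : (1 : _) ≤ v ρ ^ 3 := one_le_pow₀ h
    exact absurd (lt_of_le_of_lt this hlt) (not_lt.mpr (pow_le_one₀ zero_le ht1.le))
  have hid : 63 * K = -ρ ^ 4 + 16 * ρ ^ 3 - 72 * ρ ^ 2 + 9 * K * ρ + 432 := by
    linear_combination hr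
  have hRlt : v (-ρ ^ 4 + 16 * ρ ^ 3 - 72 * ρ ^ 2 + 9 * K * ρ + 432) < t ^ 2 := by
    have l1 : v (-ρ ^ 4) < t ^ 2 := by
      rw [Valuation.map_neg, map_pow]
      calc v ρ ^ 4 = v ρ ^ 3 * v ρ := pow_succ _ _
        _ ≤ v ρ ^ 3 * 1 := mul_le_mul' le_rfl hρ1
        _ = v ρ ^ 3 := mul_one _
        _ < t ^ 2 := hlt
    have l2 : v (16 * ρ ^ 3) < t ^ 2 := by
      rw [map_mul, map_pow]
      calc v 16 * v ρ ^ 3 ≤ 1 * v ρ ^ 3 := mul_le_mul' (by exact_mod_cast hle1 16) le_rfl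
        _ = v ρ ^ 3 := one_mul _
        _ < t ^ 2 := hlt
    have l3 : v (72 * ρ ^ 2) < t ^ 2 := by
      rw [show (72 : AlgebraicClosure ℚ) = 8 * 3 ^ 2 by norm_num, map_mul, map_mul, map_pow, map_pow]
      calc v 8 * t ^ 2 * v ρ ^ 2 ≤ 1 * t ^ 2 * v ρ ^ 2 :=
            mul_le_mul' (mul_le_mul' (by exact_mod_cast hle1 8) le_rfl) le_rfl
        _ = t ^ 2 * v ρ ^ 2 := by rw [one_mul]
        _ < t ^ 2 * 1 := mul_lt_mul_of_pos_left (pow_lt_one₀ zero_le hρlt1 two_ne_zero)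
            (pow_pos ht0' 2)
        _ = t ^ 2 := mul_one _
    have l4 : v (9 * K * ρ) < t ^ 2 := by
      rw [map_mul, map_mul, h9, hK, mul_one]
      calc t ^ 2 * v ρ < t ^ 2 * 1 := mul_lt_mul_of_pos_left hρlt1 (pow_pos ht0' 2)
        _ = t ^ 2 := mul_one _
    exact Valuation.map_add_lt _
      (Valuation.map_add_lt _ (Valuation.map_sub_lt _ (Valuation.map_add_lt _ l1 l2) l3) l4)
      (h432.trans_lt ht32)
  rw [← hid] at hRlt
  exact absurd h63 hRlt.ne

/-! ### §2 The two factors of `(2 + ρ)²ρ⁶ − 81` -/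

/-- **`v(F₋)·v(F₊) = v(3)⁴·v(ρ)`** for
`F₋ = 126(K − 8) + 9ρ(5K − 47) + 9ρ²(16 − K) + 72ρ³`,
`F₊ = 18(7K − 40) + 9ρ(5K − 49) + 9ρ²(16 − K) + 72ρ³`, when `v(K) = 1`, `v(ρ)³ = v(3)²` and
`K ≡ ±1 (mod 3)` (`v(K − 1) ≤ v(3)` or `v(K + 1) ≤ v(3)`): if `K ≡ −1` then `v(F₋) = v(9ρ)`
(`5K − 47 = 5(K + 1) − 52` is a unit, the other terms are smaller) and `v(F₊) = v(9)`
(`7K − 40 = 7(K + 1) − 47` is a unit); if `K ≡ 1` then `v(F₋) = v(9)` (`K − 8 = (K − 1) − 7`)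
and `v(F₊) = v(9ρ)` (`5K − 49 = 5(K − 1) − 44`). [folklore] -/
theorem valuation_factors_of_quartic_five {ρ K : AlgebraicClosure ℚ}
    (hK : (placeOver 3).valuation K = 1)
    (hKpm : (placeOver 3).valuation (K - 1) ≤ (placeOver 3).valuation (3 : AlgebraicClosure ℚ) ∨
      (placeOver 3).valuation (K + 1) ≤ (placeOver 3).valuation (3 : AlgebraicClosure ℚ))
    (hρ : (placeOver 3).valuation ρ ^ 3 = (placeOver 3).valuation (3 : AlgebraicClosure ℚ) ^ 2) :
    (placeOver 3).valuation (126 * (K - 8) + 9 * ρ * (5 * K - 47) + 9 * ρ ^ 2 * (16 - K) +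
          72 * ρ ^ 3) *
        (placeOver 3).valuation (18 * (7 * K - 40) + 9 * ρ * (5 * K - 49) + 9 * ρ ^ 2 * (16 - K) +
          72 * ρ ^ 3) =
      (placeOver 3).valuation (3 : AlgebraicClosure ℚ) ^ 4 * (placeOver 3).valuation ρ := by
  set v := (placeOver 3).valuation with hv
  set t := v (3 : AlgebraicClosure ℚ) with ht
  set s := v ρ with hs
  have ht1 : t < 1 := valuation_three_lt_one
  have ht0 : t ≠ 0 := valuation_three_ne_zero
  have ht0' : 0 < t := zero_lt_iff.mpr ht0
  have hle1 : ∀ n : ℕ, v (n : AlgebraicClosure ℚ) ≤ 1 := fun n ↦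
    ((placeOver 3).valuation_le_one_iff _).mpr (natCast_mem (placeOver 3) n)
  have hunit : ∀ n : ℤ, ¬ (3 : ℤ) ∣ n → v (n : AlgebraicClosure ℚ) = 1 := fun n hn ↦
    valuation_intCast_eq_one_of_not_dvd hn
  have h9 : v (9 : AlgebraicClosure ℚ) = t ^ 2 := by
    rw [show (9 : AlgebraicClosure ℚ) = 3 ^ 2 by norm_num, map_pow]
  have h18 : v (18 : AlgebraicClosure ℚ) = t ^ 2 := by
    rw [show (18 : AlgebraicClosure ℚ) = 2 * 3 ^ 2 by norm_num, map_mul, map_pow]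
    have : v (2 : AlgebraicClosure ℚ) = 1 := by simpa using hunit 2 (by decide)
    rw [this, one_mul]
  have h126 : v (126 : AlgebraicClosure ℚ) = t ^ 2 := by
    rw [show (126 : AlgebraicClosure ℚ) = 14 * 3 ^ 2 by norm_num, map_mul, map_pow]
    have : v (14 : AlgebraicClosure ℚ) = 1 := by simpa using hunit 14 (by decide)
    rw [this, one_mul]
  have h72 : v (72 * ρ ^ 3) = t ^ 4 := by
    rw [show (72 : AlgebraicClosure ℚ) = 8 * 3 ^ 2 by norm_num, map_mul, map_mul, map_pow, map_pow]
    have : v (8 : AlgebraicClosure ℚ) = 1 := by simpa using hunit 8 (by decide)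
    rw [this, one_mul, ← hs, hρ, ← pow_add]
  -- orders of magnitude: `t < s < 1`, `s³ = t²`
  have hs1 : s < 1 := by
    by_contra h
    rw [not_lt] at h
    have : (1 : _) ≤ s ^ 3 := one_le_pow₀ h
    rw [hρ] at this
    exact absurd this (not_le.mpr (pow_lt_one₀ zero_le ht1 two_ne_zero))
  have hs0' : 0 < s := by
    rcases eq_or_lt_of_le (zero_le : (0 : _) ≤ s) with h | h
    · exfalso
      have : s ^ 3 = 0 := by rw [← h, zero_pow three_ne_zero]
      rw [hρ] at this
      exact pow_ne_zero 2 ht0 this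
    · exact h
  have hts : t < s := by
    refine lt_of_pow_lt_pow_left₀ 3 hs0'.le ?_
    rw [hρ, pow_succ]
    calc t ^ 2 * t < t ^ 2 * 1 := mul_lt_mul_of_pos_left ht1 (pow_pos ht0' 2)
      _ = t ^ 2 := mul_one _
  have ht2s : t ^ 2 * s ^ 2 < t ^ 2 * s := by
    refine mul_lt_mul_of_pos_left ?_ (pow_pos ht0' 2)
    calc s ^ 2 = s * s := pow_two s
      _ < s * 1 := mul_lt_mul_of_pos_left hs1 hs0'
      _ = s := mul_one s
  have ht4 : t ^ 4 < t ^ 2 * s := by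
    rw [show (4 : ℕ) = 2 + 2 from rfl, pow_add]
    refine mul_lt_mul_of_pos_left ?_ (pow_pos ht0' 2)
    calc t ^ 2 = t * t := pow_two t
      _ < t * 1 := mul_lt_mul_of_pos_left ht1 ht0'
      _ = t := mul_one t
      _ < s := hts
  have ht3 : t ^ 3 < t ^ 2 * s := by
    rw [pow_succ]; exact mul_lt_mul_of_pos_left hts (pow_pos ht0' 2)
  have ht2s1 : t ^ 2 * s < t ^ 2 := by
    calc t ^ 2 * s < t ^ 2 * 1 := mul_lt_mul_of_pos_left hs1 (pow_pos ht0' 2)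
      _ = t ^ 2 := mul_one _
  -- the common small terms
  have hc1 : v (9 * ρ ^ 2 * (16 - K)) ≤ t ^ 2 * s ^ 2 := by
    rw [map_mul, map_mul, map_pow, h9]
    calc t ^ 2 * s ^ 2 * v (16 - K) ≤ t ^ 2 * s ^ 2 * 1 := by
          refine mul_le_mul' le_rfl ((Valuation.map_sub _ _ _).trans (max_le ?_ hK.le))
          exact_mod_cast hle1 16
      _ = t ^ 2 * s ^ 2 := mul_one _
  -- a linear term `9ρ(5K − c)`: exact value `t² s` if `5K − c` is a unit, `≤ t³ s` if `3 ∣ 5K − c`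
  have hlin_eq : ∀ c : AlgebraicClosure ℚ, v (5 * K - c) = 1 → v (9 * ρ * (5 * K - c)) = t ^ 2 * s := by
    intro c hc; rw [map_mul, map_mul, h9, hc, mul_one]
  have hlin_le : ∀ c : AlgebraicClosure ℚ, v (5 * K - c) ≤ t → v (9 * ρ * (5 * K - c)) < t ^ 2 := by
    intro c hc
    rw [map_mul, map_mul, h9]
    calc t ^ 2 * s * v (5 * K - c) ≤ t ^ 2 * s * t := mul_le_mul' le_rfl hc
      _ = t ^ 2 * (s * t) := mul_assoc _ _ _
      _ < t ^ 2 * 1 := by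
          refine mul_lt_mul_of_pos_left ?_ (pow_pos ht0' 2)
          calc s * t < s * 1 := mul_lt_mul_of_pos_left ht1 hs0'
            _ = s := mul_one s
            _ < 1 := hs1
      _ = t ^ 2 := mul_one _
  -- `a·u − w` is a unit when `v(u) ≤ t` and `w` is an integer prime to `3`; `≤ t` when `3 ∣ w`
  have hau : ∀ (a : ℕ) (u : AlgebraicClosure ℚ), v u ≤ t → v ((a : AlgebraicClosure ℚ) * u) ≤ t := by
    intro a u hu
    rw [map_mul]
    calc v (a : AlgebraicClosure ℚ) * v u ≤ 1 * t := mul_le_mul' (hle1 a) hu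
      _ = t := one_mul t
  have hshift_unit : ∀ (a : ℕ) (u : AlgebraicClosure ℚ) (w : ℤ), v u ≤ t → ¬ (3 : ℤ) ∣ w →
      v ((a : AlgebraicClosure ℚ) * u - w) = 1 := by
    intro a u w hu hw
    have hlt : v ((a : AlgebraicClosure ℚ) * u) < v (w : AlgebraicClosure ℚ) := by
      rw [hunit w hw]; exact (hau a u hu).trans_lt ht1
    rw [valuation_sub_eq_of_lt' hlt, hunit w hw]
  have hshift_le : ∀ (a : ℕ) (u : AlgebraicClosure ℚ) (w : ℤ), v u ≤ t → (3 : ℤ) ∣ w →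
      v ((a : AlgebraicClosure ℚ) * u - w) ≤ t := by
    intro a u w hu hw
    refine (Valuation.map_sub _ _ _).trans (max_le (hau a u hu) ?_)
    obtain ⟨k, hk⟩ := hw
    rw [hk, Int.cast_mul, map_mul, Int.cast_ofNat]
    calc t * v (k : AlgebraicClosure ℚ) ≤ t * 1 :=
          mul_le_mul' le_rfl (((placeOver 3).valuation_le_one_iff _).mpr (intCast_mem (placeOver 3) k))
      _ = t := mul_one t
  rcases hKpm with h1 | h1
  · -- `K ≡ 1 (mod 3)`: `F₋` is dominated by `126(K − 8)`, `F₊` by `9ρ(5K − 49)`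
    have hK8 : v (K - 8) = 1 := by
      have h' := hshift_unit 1 (K - 1) 7 h1 (by decide)
      rw [show ((1 : ℕ) : AlgebraicClosure ℚ) * (K - 1) - ((7 : ℤ) : AlgebraicClosure ℚ) = K - 8
        by push_cast; ring] at h'
      exact h'
    have h47 : v (5 * K - 47) ≤ t := by
      have h' := hshift_le 5 (K - 1) 42 h1 ⟨14, by norm_num⟩
      rw [show ((5 : ℕ) : AlgebraicClosure ℚ) * (K - 1) - ((42 : ℤ) : AlgebraicClosure ℚ) = 5 * K - 47
        by push_cast; ring] at h'
      exact h'
    have h49 : v (5 * K - 49) = 1 := by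
      have h' := hshift_unit 5 (K - 1) 44 h1 (by decide)
      rw [show ((5 : ℕ) : AlgebraicClosure ℚ) * (K - 1) - ((44 : ℤ) : AlgebraicClosure ℚ) = 5 * K - 49
        by push_cast; ring] at h'
      exact h'
    have h40 : v (7 * K - 40) ≤ t := by
      have h' := hshift_le 7 (K - 1) 33 h1 ⟨11, by norm_num⟩
      rw [show ((7 : ℕ) : AlgebraicClosure ℚ) * (K - 1) - ((33 : ℤ) : AlgebraicClosure ℚ) = 7 * K - 40
        by push_cast; ring] at h'
      exact h'
    have hFm : v (126 * (K - 8) + 9 * ρ * (5 * K - 47) + 9 * ρ ^ 2 * (16 - K) + 72 * ρ ^ 3) =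
        t ^ 2 := by
      have hmain : v (126 * (K - 8)) = t ^ 2 := by rw [map_mul, h126, hK8, mul_one]
      have hrest : v (9 * ρ * (5 * K - 47) + 9 * ρ ^ 2 * (16 - K) + 72 * ρ ^ 3) <
          v (126 * (K - 8)) := by
        rw [hmain]
        refine Valuation.map_add_lt _ (Valuation.map_add_lt _ (hlin_le _ h47) ?_) (h72.trans_lt ?_)
        · exact hc1.trans_lt (ht2s.trans ht2s1)
        · exact ht4.trans ht2s1
      rw [show (126 * (K - 8) + 9 * ρ * (5 * K - 47) + 9 * ρ ^ 2 * (16 - K) + 72 * ρ ^ 3 :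
          AlgebraicClosure ℚ) = 126 * (K - 8) + (9 * ρ * (5 * K - 47) + 9 * ρ ^ 2 * (16 - K) +
          72 * ρ ^ 3) by ring, Valuation.map_add_eq_of_lt_left _ hrest, hmain]
    have hFp : v (18 * (7 * K - 40) + 9 * ρ * (5 * K - 49) + 9 * ρ ^ 2 * (16 - K) + 72 * ρ ^ 3) =
        t ^ 2 * s := by
      have hmain : v (9 * ρ * (5 * K - 49)) = t ^ 2 * s := hlin_eq _ h49
      have hrest : v (18 * (7 * K - 40) + 9 * ρ ^ 2 * (16 - K) + 72 * ρ ^ 3) <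
          v (9 * ρ * (5 * K - 49)) := by
        rw [hmain]
        refine Valuation.map_add_lt _ (Valuation.map_add_lt _ ?_ (hc1.trans_lt ht2s)) (h72.trans_lt ht4)
        rw [map_mul, h18]
        calc t ^ 2 * v (7 * K - 40) ≤ t ^ 2 * t := mul_le_mul' le_rfl h40
          _ = t ^ 3 := by rw [← pow_succ]
          _ < t ^ 2 * s := ht3
      rw [show (18 * (7 * K - 40) + 9 * ρ * (5 * K - 49) + 9 * ρ ^ 2 * (16 - K) + 72 * ρ ^ 3 :
          AlgebraicClosure ℚ) = 9 * ρ * (5 * K - 49) + (18 * (7 * K - 40) + 9 * ρ ^ 2 * (16 - K) +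
          72 * ρ ^ 3) by ring, Valuation.map_add_eq_of_lt_left _ hrest, hmain]
    rw [hFm, hFp, ← mul_assoc, ← pow_add]
  · -- `K ≡ −1 (mod 3)`: `F₋` is dominated by `9ρ(5K − 47)`, `F₊` by `18(7K − 40)`
    have hK8 : v (K - 8) ≤ t := by
      have h' := hshift_le 1 (K + 1) 9 h1 ⟨3, by norm_num⟩
      rw [show ((1 : ℕ) : AlgebraicClosure ℚ) * (K + 1) - ((9 : ℤ) : AlgebraicClosure ℚ) = K - 8
        by push_cast; ring] at h'
      exact h'
    have h47 : v (5 * K - 47) = 1 := by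
      have h' := hshift_unit 5 (K + 1) 52 h1 (by decide)
      rw [show ((5 : ℕ) : AlgebraicClosure ℚ) * (K + 1) - ((52 : ℤ) : AlgebraicClosure ℚ) = 5 * K - 47
        by push_cast; ring] at h'
      exact h'
    have h49 : v (5 * K - 49) ≤ t := by
      have h' := hshift_le 5 (K + 1) 54 h1 ⟨18, by norm_num⟩
      rw [show ((5 : ℕ) : AlgebraicClosure ℚ) * (K + 1) - ((54 : ℤ) : AlgebraicClosure ℚ) = 5 * K - 49
        by push_cast; ring] at h'
      exact h'
    have h40 : v (7 * K - 40) = 1 := by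
      have h' := hshift_unit 7 (K + 1) 47 h1 (by decide)
      rw [show ((7 : ℕ) : AlgebraicClosure ℚ) * (K + 1) - ((47 : ℤ) : AlgebraicClosure ℚ) = 7 * K - 40
        by push_cast; ring] at h'
      exact h'
    have hFm : v (126 * (K - 8) + 9 * ρ * (5 * K - 47) + 9 * ρ ^ 2 * (16 - K) + 72 * ρ ^ 3) =
        t ^ 2 * s := by
      have hmain : v (9 * ρ * (5 * K - 47)) = t ^ 2 * s := hlin_eq _ h47
      have hrest : v (126 * (K - 8) + 9 * ρ ^ 2 * (16 - K) + 72 * ρ ^ 3) <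
          v (9 * ρ * (5 * K - 47)) := by
        rw [hmain]
        refine Valuation.map_add_lt _ (Valuation.map_add_lt _ ?_ (hc1.trans_lt ht2s)) (h72.trans_lt ht4)
        rw [map_mul, h126]
        calc t ^ 2 * v (K - 8) ≤ t ^ 2 * t := mul_le_mul' le_rfl hK8
          _ = t ^ 3 := by rw [← pow_succ]
          _ < t ^ 2 * s := ht3
      rw [show (126 * (K - 8) + 9 * ρ * (5 * K - 47) + 9 * ρ ^ 2 * (16 - K) + 72 * ρ ^ 3 :
          AlgebraicClosure ℚ) = 9 * ρ * (5 * K - 47) + (126 * (K - 8) + 9 * ρ ^ 2 * (16 - K) +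
          72 * ρ ^ 3) by ring, Valuation.map_add_eq_of_lt_left _ hrest, hmain]
    have hFp : v (18 * (7 * K - 40) + 9 * ρ * (5 * K - 49) + 9 * ρ ^ 2 * (16 - K) + 72 * ρ ^ 3) =
        t ^ 2 := by
      have hmain : v (18 * (7 * K - 40)) = t ^ 2 := by rw [map_mul, h18, h40, mul_one]
      have hrest : v (9 * ρ * (5 * K - 49) + 9 * ρ ^ 2 * (16 - K) + 72 * ρ ^ 3) <
          v (18 * (7 * K - 40)) := by
        rw [hmain]
        refine Valuation.map_add_lt _ (Valuation.map_add_lt _ (hlin_le _ h49) ?_) (h72.trans_lt ?_)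
        · exact hc1.trans_lt (ht2s.trans ht2s1)
        · exact ht4.trans ht2s1
      rw [show (18 * (7 * K - 40) + 9 * ρ * (5 * K - 49) + 9 * ρ ^ 2 * (16 - K) + 72 * ρ ^ 3 :
          AlgebraicClosure ℚ) = 18 * (7 * K - 40) + (9 * ρ * (5 * K - 49) + 9 * ρ ^ 2 * (16 - K) +
          72 * ρ ^ 3) by ring, Valuation.map_add_eq_of_lt_left _ hrest, hmain]
    rw [hFm, hFp, mul_assoc, mul_comm s, ← mul_assoc, ← pow_add]

end Summit.BirchSwinnertonDyer.Rank1Residual.GaloisImage
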